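import Mathlib.LinearAlgebra.Span.Basic
import Mathlib.LinearAlgebra.ExteriorPower.Basic
import Mathlib.Algebra.Module.Submodule.Bilinear
import Literature.AlgebraicGeometry.Motives.Varieties
import Literature.AlgebraicGeometry.Motives.Cycles
import Literature.AlgebraicGeometry.Motives.PreWeilCohomology
import Literature.AlgebraicGeometry.Motives.WeilCohomology
import Literature.AlgebraicGeometry.Motives.Lefschetz
import Literature.AlgebraicGeometry.Motives.Correspondences
import HarnessLib

-- provenance: harness21/H21/H21/Prelude/MotiveL/MotivatedCycles.lean @ 154134c (interim HEAD d8f2665); M5 mechanical rewrite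
/-!
# Motivated cycles and iterated cup products (trunk MotiveL, prelude C16)

For a Weil cohomology theory `W` (`Literature.WeilCohomology k K`), André, *Pour une théorie
inconditionnelle des motifs*, Publ. Math. IHÉS 83 (1996), Déf. 1, defines the **motivated
classes** on a smooth projective `X` as the classes `pr_{X*} (α ∪ ⋆ β) ∈ H²ᵖ(X)` where `Y` is an
auxiliary smooth projective variety, `α, β` are algebraic classes (with `ℚ`-coefficients) on
`X × Y` and `⋆` is the Lefschetz involution of `X × Y` for a product polarisation. They form a
graded `ℚ`-subalgebra `A_mot(X) ⊇ A(X)_ℚ`, stable under pull-back, and `A_mot = A_ℚ` for all `X`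
iff Grothendieck's standard conjecture of Lefschetz type `B` holds (André 1996 Thm. 0.3,
§2.1 Déf. 1, the remark following it, and Prop. 2.1).

This file also provides the glue used by the Weil-class statements (`hodge.S32`): iterated cup
products `H¹(X)^g → Hᵍ(X)`, the induced map `⋀ᵍ H¹(X) → Hᵍ(X)`, and the cup-closure of a family
of subsets of `H•(X)`.

## Main definitions

* `WeilCohomology.IsMotivatedClass W n X p x` : `x ∈ H²ᵖ(X)` (`X` of dimension `n`) is of the
  form `pr_{X*} (α ∪ ⋆ β)` (relational form, André 1996 Déf. 1).
* `WeilCohomology.motivatedClasses W n X p` : the `K`-span of motivated classes in `H²ᵖ(X)`;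
  `WeilCohomology.ratMotivatedClasses W n X p` : the subgroup they generate (André's `ℚ`-space).
* `PreWeilCohomology.HasProdHyperplaneClasses W` : the hypothesis on `W` that exterior sums
  `pr₁* η_X + pr₂* η_Y` of hyperplane classes are hyperplane classes of `X × Y` (the Segre
  compatibility of the cycle map, not derivable from the C-lite axioms), under which André's
  proofs of Prop. 2.1 apply to `motivatedClasses` (`motivatedClasses_cup_le`,
  `motivatedClasses_map_pullback_le`).
* `PreWeilCohomology.cupIter W X g v = v 0 ∪ v 1 ∪ ⋯ ∪ v (g-1) ∈ Hᵍ(X)` for `v : Fin g → H¹(X)`.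
* `PreWeilCohomology.IsCupAlternating W X g φ` : the alternating map `φ` computes `cupIter`;
  `PreWeilCohomology.wedgeToCohomology φ : ⋀ᵍ H¹(X) →ₗ Hᵍ(X)`.
* `PreWeilCohomology.IsCupClosed W X F`, `PreWeilCohomology.cupClosure W X S` : the smallest
  cup-closed family of subspaces of `H•(X)` containing `S` and `1`.

## Design choices

* As in the rest of the trunk, degrees are natural numbers with explicit degree equations; the
  push-forward `pr_{X*}` is not constructed (it needs Poincaré duality) but characterised by the
  projection formula `tr_X (x ∪ y) = tr_{X×Y} ((α ∪ ⋆β) ∪ pr_X* y)` for all `y`, exactly as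
  `PreWeilCohomology.IsInducedBy` does for correspondences.
* André polarises `X × Y` by the product polarisation `η_X ⊗ 1 + 1 ⊗ η_Y` of arbitrary ample
  classes (Déf. 1, p. 14); `IsMotivatedClass` allows instead any hyperplane class `η` of `X × Y`
  (`W.IsHyperplaneClass`, the only ampleness notion for cohomology classes in this axiomatics)
  and any operator `S` satisfying Kleiman's characterisation `W.IsLefschetzStar (n + m) η S` of
  `⋆` (unique under hard Lefschetz, `WeilCohomology.existsUnique_isLefschetzStar`). André's
  Déf. 1 verbatim (product polarisations) is vendored separately as
  `WeilCohomology.IsProdMotivatedClass` / `WeilCohomology.prodMotivatedClasses`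
  (`Motives/MotivatedCyclesProduct.lean`, whose module docstring compares the two forms). The two
  spans agree for every classical cohomology theory (André 1996 §3.2, Remarque p. 21: the
  Lefschetz involution of any other polarisation is a motivated correspondence, so the spaces
  `A_mot(X)_E` do not depend on the chosen polarisations), but relating them inside this
  axiomatics — and running the printed proofs of Prop. 2.1 for the present variant, which pass
  through the exterior sum of the polarisations of two auxiliary products (Lemme 1.3.2) —
  requires exterior sums of hyperplane classes to be hyperplane classes. This is true geometrically
  (Segre and Veronese embeddings) but **not** derivable from the C-lite axioms of
  `Literature.AlgebraicGeometry.Motives.WeilCohomology` (no compatibility of the cycle map with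
  pull-back of divisors; cf. the module docstring of `Motives/StandardConjectures.lean`). It is
  therefore recorded as the hypothesis `PreWeilCohomology.HasProdHyperplaneClasses`, carried
  explicitly by `motivatedClasses_cup_le` and `motivatedClasses_map_pullback_le` next to
  `W.HasHardLefschetz` (restated 2026-08-15: the earlier versions of these two named facts omitted
  it and were not provable as stated).
* `motivatedClasses` is the `K`-span (André works with `ℚ`-coefficients; `W.algebraicClasses` is
  likewise a `K`-span, so `B ⇒ A_mot = A` is stated as an equality of `K`-subspaces).
* For `p > n` the defining condition is vacuous; this is harmless since `H²ᵖ(X) = 0` there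
  (`WeilCohomology.subsingleton_obj`).
* Mathlib has no Weil cohomology / motivated-cycle vocabulary (searched `motivated`,
  `Lefschetz`, `cycleClass`); we use Mathlib's `Submodule.span`, `Submodule.map₂`,
  `AlternatingMap` (`M [⋀^Fin g]→ₗ[K] N`), `exteriorPower.alternatingMapLinearEquiv` and the
  complete lattice of (families of) submodules.

## References

* Y. André, *Pour une théorie inconditionnelle des motifs*, Publ. Math. IHÉS 83 (1996), 5–49:
  Thm. 0.3, §1.3 (Lemme 1.3.1, Lemme 1.3.2), §2.1 (Déf. 1 and the remark following it, p. 14;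
  Prop. 2.1 and its proof, pp. 14–15; the `f^*, f_*` formalism after the Corollaire, p. 15),
  §3.2 (Remarque p. 21). [Andre1996Motifs]
* S. Kleiman, *Algebraic cycles and the Weil conjectures* (1968), §1.2 (axiom (C)), §1.3–1.4.
  [Kleiman1968]
* R. Hartshorne, *Algebraic Geometry* (1977), II Ex. 5.11–5.12 (Segre embedding, `𝒪(1)` of a
  product). [Hartshorne1977]
-/

universe u v

open CategoryTheory AlgebraicGeometry MonoidalCategory CartesianMonoidalCategory
open scoped TensorProduct

noncomputable section

namespace Literature.AlgebraicGeometry.Motives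

/-! ## Exterior sums of hyperplane classes -/

namespace PreWeilCohomology

variable {k : Type u} [Field k] {K : Type v} [Field K]

/-- The (pre-)Weil cohomology theory `W` *has product hyperplane classes*: for smooth projective
`X`, `Y` (of dimensions `n`, `m`) and hyperplane classes `η_X ∈ H²(X)`, `η_Y ∈ H²(Y)`
(`W.IsHyperplaneClass`: pull-backs of classes of effective divisors of `ℙᴺ` along closed
immersions), the exterior sum `pr₁* η_X + pr₂* η_Y ∈ H²(X × Y)` — André's product polarisation
`[X] ⊗ η_Y + η_X ⊗ [Y]` (André 1996 §1.3, §2.1 Déf. 1; Kleiman 1968 §1.4) — is again a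
hyperplane class of `X × Y`.

This is a property of every Weil cohomology theory in Kleiman's sense, being a cohomological
shadow of axiom (C) of Kleiman 1968 §1.2 (compatibility `f* γ = γ f*` of the cycle map with
pull-back of cycles): if `η_X = ι_X* γ(D)` and `η_Y = ι_Y* γ(D')` with `D ∼ d·H`, `D' ∼ d'·H'`
effective and nonzero, then `pr₁* η_X + pr₂* η_Y` is the pull-back of the class of a hyperplane
along the closed immersion `X × Y ↪ ℙᴺ × ℙᴺ' ↪ ℙᴬ × ℙᴮ ↪ ℙᴹ` (Veronese embeddings of degrees
`d`, `d'`, then the Segre embedding; Hartshorne 1977 II Ex. 5.11–5.12). It is **not** derivable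
from the C-lite axioms of `Literature.AlgebraicGeometry.Motives.WeilCohomology`, which omit that
compatibility (see the module docstrings of `Motives/StandardConjectures.lean` and
`Motives/MotivatedCyclesProduct.lean`), so statements whose printed proofs pass through product
polarisations carry it as an explicit hypothesis, in the same way as
`WeilCohomology.HasHardLefschetz`. [cite: Kleiman1968, §1.2 (C) and §1.4] -/
def HasProdHyperplaneClasses (W : PreWeilCohomology k K) : Prop :=
  ∀ ⦃n : ℕ⦄ ⦃X : SchemeOver k⦄, IsSmoothProjective n X →
    ∀ ⦃m : ℕ⦄ ⦃Y : SchemeOver k⦄, IsSmoothProjective m Y →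
      ∀ ⦃ηX : W.obj X 2⦄ ⦃ηY : W.obj Y 2⦄, W.IsHyperplaneClass X ηX → W.IsHyperplaneClass Y ηY →
        W.IsHyperplaneClass (X ⊗ Y) (W.pullback (fst X Y) 2 ηX + W.pullback (snd X Y) 2 ηY)

/-- Under `W.HasProdHyperplaneClasses`, the exterior sum `pr₁* η_X + pr₂* η_Y` of hyperplane
classes of smooth projective `X`, `Y` is a hyperplane class of `X × Y` (the hypothesis,
unfolded). [folklore] -/
lemma HasProdHyperplaneClasses.isHyperplaneClass_add {W : PreWeilCohomology k K}
    (hP : W.HasProdHyperplaneClasses) {n m : ℕ} {X Y : SchemeOver k}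
    (hX : IsSmoothProjective n X) (hY : IsSmoothProjective m Y) {ηX : W.obj X 2} {ηY : W.obj Y 2}
    (hηX : W.IsHyperplaneClass X ηX) (hηY : W.IsHyperplaneClass Y ηY) :
    W.IsHyperplaneClass (X ⊗ Y) (W.pullback (fst X Y) 2 ηX + W.pullback (snd X Y) 2 ηY) :=
  hP hX hY hηX hηY

end PreWeilCohomology

/-! ## Motivated classes -/

namespace WeilCohomology

variable {k : Type u} [Field k] {K : Type v} [Field K] [CharZero K] (W : WeilCohomology k K)

/-- A class `x ∈ H²ᵖ(X)` (`X` smooth projective of dimension `n`) *is a motivated class* in the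
sense of André 1996, Déf. 1: there are a smooth projective `Y` of dimension `m`, a hyperplane
class `η` on `X × Y` with a Lefschetz involution `⋆ = S` (`W.IsLefschetzStar (n + m) η S`), and
rational algebraic classes `α ∈ Aᵃ(X × Y)_ℚ`, `β ∈ Aᵇ(X × Y)_ℚ` (with `⋆β ∈ H^{2b'}`,
`b + b' = n + m`, `a + b' = p + m`) such that `x = pr_{X*} (α ∪ ⋆β)`, the push-forward being
expressed by the projection formula: for every `y ∈ H^{2q}(X)`, `p + q = n`,
`tr_X (x ∪ y) = tr_{X×Y} ((α ∪ ⋆β) ∪ pr_X* y)`. See the module docstring (Design choices) and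
`PreWeilCohomology.HasProdHyperplaneClasses` for the comparison with André's product
polarisations. [cite: Andre1996Motifs, §2.1 Déf. 1 (p. 14)] -/
def IsMotivatedClass (n : ℕ) (X : SchemeOver k) (p : ℕ) (x : W.obj X (2 * p)) : Prop :=
  ∃ (m : ℕ) (Y : SchemeOver k) (_ : IsSmoothProjective m Y) (η : W.obj (X ⊗ Y) 2)
    (_ : W.IsHyperplaneClass (X ⊗ Y) η) (S : W.GradedOp (X ⊗ Y) (X ⊗ Y))
    (_ : W.IsLefschetzStar (n + m) η S) (a b b' : ℕ) (_ : b + b' = n + m)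
    (hab : a + b' = p + m) (α : W.obj (X ⊗ Y) (2 * a)) (β : W.obj (X ⊗ Y) (2 * b)),
    α ∈ W.ratAlgebraicClasses (X ⊗ Y) a ∧ β ∈ W.ratAlgebraicClasses (X ⊗ Y) b ∧
      ∀ (q : ℕ) (hq : p + q = n) (y : W.obj X (2 * q)),
        W.cupPairing X n (2 * p) (2 * q) (by omega) x y =
          W.trace (X ⊗ Y) (n + m)
            (W.cup (show 2 * (p + m) + 2 * q = 2 * (n + m) by omega)
              (W.cup (show 2 * a + 2 * b' = 2 * (p + m) by omega) α (S (2 * b) (2 * b') β))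
              (W.pullback (fst X Y) (2 * q) y))

/-- The `K`-subspace `A_mot^p(X) ⊆ H²ᵖ(X)` of **motivated classes** (André 1996, Déf. 1 and
Prop. 2.1): the span of the classes `pr_{X*} (α ∪ ⋆β)` (`W.IsMotivatedClass`). [cite: Andre1996Motifs, §2.1 Déf. 1 (p. 14)] -/
def motivatedClasses (n : ℕ) (X : SchemeOver k) (p : ℕ) : Submodule K (W.obj X (2 * p)) :=
  Submodule.span K {x | W.IsMotivatedClass n X p x}

/-- The subgroup `A_mot^p(X)` of `H²ᵖ(X)` generated by the motivated classes
`pr_{X*} (α ∪ ⋆β)` (André 1996, Déf. 1, with André's `ℚ`-coefficients: since `α`, `β` range over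
the divisible groups `A(X × Y)_ℚ = W.ratAlgebraicClasses`, the generating set is stable under
`ℚ`, so this is André's `ℚ`-space `A_mot^p(X)`; its `K`-span is `W.motivatedClasses`). [cite: Andre1996Motifs, §2.1 Déf. 1 (p. 14)] -/
def ratMotivatedClasses (n : ℕ) (X : SchemeOver k) (p : ℕ) : AddSubgroup (W.obj X (2 * p)) :=
  AddSubgroup.closure {x | W.IsMotivatedClass n X p x}

variable {W}
variable {n : ℕ} {X : SchemeOver k}

/-- A motivated class lies in `motivatedClasses`. [folklore] -/
lemma IsMotivatedClass.mem_motivatedClasses {p : ℕ} {x : W.obj X (2 * p)}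
    (hx : W.IsMotivatedClass n X p x) : x ∈ W.motivatedClasses n X p :=
  Submodule.subset_span hx

/-- A motivated class lies in `ratMotivatedClasses`. [folklore] -/
lemma IsMotivatedClass.mem_ratMotivatedClasses {p : ℕ} {x : W.obj X (2 * p)}
    (hx : W.IsMotivatedClass n X p x) : x ∈ W.ratMotivatedClasses n X p :=
  AddSubgroup.subset_closure hx

/-- `A_mot^p(X)` (with `ℚ`-coefficients) is contained in its `K`-span. [folklore] -/
lemma ratMotivatedClasses_subset_motivatedClasses (p : ℕ) :
    (W.ratMotivatedClasses n X p : Set (W.obj X (2 * p))) ⊆ W.motivatedClasses n X p :=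
  (AddSubgroup.closure_le (W.motivatedClasses n X p).toAddSubgroup).mpr Submodule.subset_span

/-- The `K`-span of `A_mot^p(X)_ℚ` is `motivatedClasses`. [folklore] -/
lemma span_ratMotivatedClasses (p : ℕ) :
    Submodule.span K (W.ratMotivatedClasses n X p : Set (W.obj X (2 * p))) =
      W.motivatedClasses n X p :=
  le_antisymm (Submodule.span_le.mpr (ratMotivatedClasses_subset_motivatedClasses p))
    (Submodule.span_mono fun _ hx ↦ AddSubgroup.subset_closure hx)

variable (W) in
/-- **Algebraic classes are motivated** (André 1996, §2.1, the remark following Déf. 1, p. 14: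
«`A_mot(X)_E` contient `A(X)` et `⋆A(X)` (prendre `α` ou `β` égal à la classe fondamentale de
`X × Y`)»; in the relational form: take `β` the top power of the polarisation, for which
`⋆β = 1`, so that `pr_{X*} (α ∪ ⋆β) = pr_{X*} α`): `A^p(X) ⊆ A_mot^p(X)`. Discharged in
`Motives/MotivatedCyclesProofs.lean` (`algebraicClasses_le_motivatedClasses_holds`, auxiliary
variety `ℙ¹`).

Depends only on: `isSmoothProjective_unit` / `IsSmoothProjective.tensor`,
`isHyperplaneClass_nonempty`, `existsUnique_isLefschetzStar` under `W.HasHardLefschetz` for the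
auxiliary product (André's standing hypothesis that `W` satisfies hard Lefschetz), `one_cup`,
`cup_comm`, `pullback_ratAlgebraicClasses_le`, `trace_externalCup`. [cite: Andre1996Motifs, §2.1 remark following Déf. 1 (p. 14)] -/
def algebraicClasses_le_motivatedClasses : Prop :=
  W.HasHardLefschetz → ∀ {n : ℕ} {X : SchemeOver k}, IsSmoothProjective n X → ∀ p : ℕ,
    W.algebraicClasses X p ≤ W.motivatedClasses n X p

variable (W) in
/-- **`B` implies motivated = algebraic** (André 1996, §0.3 and §2.1, the remark following
Déf. 1, p. 14: «`A_mot(X) = A(X)` si pour tout schéma `Y` dans `𝒱`, polarisé, l'involution de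
Lefschetz est donnée par une correspondance algébrique», which is the case under the standard
conjecture of Lefschetz type `B`, Kleiman 1968 Prop. 2.3): if `B` holds for `W`, then every
motivated class is algebraic, `A_mot^p(X) = A^p(X)` (as `K`-subspaces of `H²ᵖ(X)`), for every
smooth projective `X`. (Conversely `A_mot = A` for all `X` implies `B`, since `⋆` is then
algebraic.) Discharged in `Motives/MotivatedCyclesLefschetzProofs.lean`. (In the paper, Thm. 0.4
is the theorem on the Tannakian category of motives; the name of this declaration is kept.)

Depends only on: `map_ratAlgebraicClasses_of_isInducedBy` (with `isAlgebraicGradedOp_comp`: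
under `B(X × Y)` the operator `⋆` is algebraic, Kleiman 1968 Prop. 2.3, so `⋆β` is rational
algebraic), `exists_isInducedBy_pullback` and `isAlgebraicGradedOp_transpose` (`pr_{X*}`
preserves rational algebraic classes), `cup_mem_ratAlgebraicClasses`, `isPerfPair_cupPairing`
(`x` is determined by the projection formula), `ratAlgebraicClasses_le_algebraicClasses`, and
`algebraicClasses_le_motivatedClasses`. [cite: Andre1996Motifs, §0.3 and §2.1 remark following Déf. 1 (p. 14)] -/
def motivatedClasses_eq_algebraicClasses_of_lefschetzStandardConjecture : Prop :=
  W.LefschetzStandardConjecture → ∀ {n : ℕ} {X : SchemeOver k}, IsSmoothProjective n X →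
    ∀ p : ℕ, W.motivatedClasses n X p = W.algebraicClasses X p

variable (W) in
/-- **Motivated classes form a subalgebra** (André 1996, §2.1, Prop. 2.1 (i), p. 14, proof
p. 15; Thm. 0.3), transcribed for the motivated classes `W.motivatedClasses` of this file: if
`W` has the hard Lefschetz property and product hyperplane classes
(`W.HasProdHyperplaneClasses`: exterior sums of hyperplane classes are hyperplane classes), then
for `X` smooth projective of dimension `n` the cup product of motivated classes of codimensions
`p` and `q` is motivated of codimension `r = p + q`.

André states (i) for Déf. 1, whose auxiliary products `X × Y` carry the product polarisations
`[X] ⊗ η_Y + η_X ⊗ [Y]` (vendored verbatim as `WeilCohomology.prodMotivatedClasses` in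
`Motives/MotivatedCyclesProduct.lean`). The printed proof (p. 15):
`pr^{XY}_{X*} (α ∪ ⋆β) ∪ pr^{XZ}_{X*} (γ ∪ ⋆δ) = pr^{XYXZ}_{X*} (pr*[Δ] ∪ (α ⊗ γ) ∪ (⋆β ⊗ ⋆δ))`,
and Lemme 1.3.2 rewrites `⋆β ⊗ ⋆δ` as a `ℚ`-combination of classes `(Lⁱ ⊗ Lʲ) ⋆ b`, with
`b = Lᵏ β ⊗ Lˡ δ` or its image under `L_{(X×Y)×(X×Z)}` (rational algebraic), for the involution
`⋆` of `(X × Y) × (X × Z)` relative to the **exterior sum** of the two polarisations (§1.3: the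
Künneth isomorphism is `𝔰𝔩₂`-equivariant for it). For the generators `W.IsMotivatedClass` (any
hyperplane class of `X × Y` as polarisation) the same computation yields a generator with
auxiliary variety `Y × X × Z` whose polarisation is that exterior sum, a hyperplane class of
`X × (Y × X × Z)` by `W.HasProdHyperplaneClasses` (transported along the associativity
isomorphism). Restated 2026-08-15 with this hypothesis: without it the inclusion is not
derivable from the C-lite axioms (verdict of the proving seat), cf. the module docstring.

Depends only on: the hypotheses `W.HasHardLefschetz` (Lefschetz decompositions and `⋆` on the
auxiliary products, `existsUnique_isLefschetzStar`; André's standing assumption) and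
`W.HasProdHyperplaneClasses`; `IsSmoothProjective.tensor`, `bijective_kunnethMap`,
`trace_externalCup`, `cup_assoc`, `cup_comm`, `map_cup`, `map_one`, `pullback_ratAlgebraicClasses_le`,
`cup_mem_ratAlgebraicClasses`, `isPerfPair_cupPairing` (push-forwards as adjoints),
`exists_isInducedBy_id` (the class `[Δ]`), rational algebraicity of hyperplane classes and their
powers, and the `𝔰𝔩₂`-calculus of André 1996 §1.2–1.3 (Lemme 1.1, Lemme 1.3.1 Clebsch–Gordan,
Lemme 1.3.2), formal under hard Lefschetz and Künneth. [cite: Andre1996Motifs, §2.1 Prop. 2.1 (i) pp. 14–15 with Lemme 1.3.2] -/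
def motivatedClasses_cup_le : Prop :=
  W.HasHardLefschetz → W.HasProdHyperplaneClasses →
    ∀ {n : ℕ} {X : SchemeOver k}, IsSmoothProjective n X → ∀ {p q r : ℕ} (h : p + q = r),
      Submodule.map₂ (W.cup (show 2 * p + 2 * q = 2 * r by omega)) (W.motivatedClasses n X p)
          (W.motivatedClasses n X q) ≤ W.motivatedClasses n X r

variable (W) in
/-- **Motivated classes are stable under pull-back** (André 1996, Thm. 0.3 (ii) and §2.1:
Prop. 2.1 (ii) for the projections, `pr* A_mot(X) ⊆ A_mot(X × Z)`, and for a general morphism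
`f` the formalism `f*` obtained by composing with the class of the transposed graph, p. 15 after
the Corollaire), transcribed for `W.motivatedClasses`: if `W` has the hard Lefschetz property and
product hyperplane classes (`W.HasProdHyperplaneClasses`), then for `f : X ⟶ Y` between smooth
projective varieties `f*` maps `A_mot^p(Y)` into `A_mot^p(X)`. Stated at the level of spans (the
pull-back of a single generator `pr_{Y*} (α ∪ ⋆β)` is in general only a *sum* of generators).

Printed proof, transcribed: `f* y = pr^{Y×X}_{X*} (pr_Y* y ∪ ᵗΓ_f)` (`exists_isInducedBy_pullback`),
so for a generator `y = pr^{YZ}_{Y*} (α ∪ ⋆β)` the class `f* y` is `pr_{X*}` of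
`α' ∪ (1_X ⊗ ⋆β)` on `X × (Y × Z)` with `α'` rational algebraic, and
`1_X ⊗ ⋆β = ⋆(η_Xⁿ) ⊗ ⋆β` (`η_X` a hyperplane class of `X`; Kleiman's normalisation
`⋆ Lⁿ 1 = 1`) is rewritten by Lemme 1.3.2 as a `ℚ`-combination of classes `a ∪ ⋆b`, `a`, `b`
rational algebraic (powers of hyperplane classes being rational algebraic), for the
involution `⋆` of `X × (Y × Z)` relative to the exterior sum of `η_X` and the polarisation of
`Y × Z` — a hyperplane class by `W.HasProdHyperplaneClasses`. Restated 2026-08-15 with this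
hypothesis: without it nothing in the C-lite axioms relates `⋆` on `Y × Z` to an involution of
`X × (Y × Z)` and the inclusion is not derivable (verdict of the proving seat), cf. the module
docstring. (The earlier docstring's locator "Prop. 2.1 (iii)" does not exist in the paper.)

Depends only on: the hypotheses `W.HasHardLefschetz` and `W.HasProdHyperplaneClasses`;
`exists_isInducedBy_pullback` (`f*` is an algebraic correspondence), `IsSmoothProjective.tensor`,
`isHyperplaneClass_nonempty` (a polarisation of `X`; `dim X = 0` is trivial),
`pullback_ratAlgebraicClasses_le`, `cup_mem_ratAlgebraicClasses`, `cup_assoc`, `cup_comm`,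
`map_cup`, `map_one`, `trace_externalCup`, `bijective_kunnethMap`, `isPerfPair_cupPairing`,
`existsUnique_isLefschetzStar`, and André 1996 Lemme 1.3.2 (formal under hard Lefschetz and
Künneth). [cite: Andre1996Motifs, §2.1 Prop. 2.1 (ii) and p. 15 (f^* via the graph of f); Thm. 0.3 (ii)] -/
def motivatedClasses_map_pullback_le : Prop :=
  W.HasHardLefschetz → W.HasProdHyperplaneClasses →
    ∀ {n m : ℕ} {X Y : SchemeOver k}, IsSmoothProjective n X → IsSmoothProjective m Y →
      ∀ (f : X ⟶ Y) (p : ℕ),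
        (W.motivatedClasses m Y p).map (W.pullback f (2 * p)) ≤ W.motivatedClasses n X p

/-- Pointwise form of `motivatedClasses_map_pullback_le` (André 1996, Thm. 0.3 (ii), §2.1 p. 15;
that named fact is the hypothesis `hpull`, its own hypotheses being `hL` and `hP`):
`y ∈ A_mot^p(Y)` implies `f* y ∈ A_mot^p(X)`. [cite: Andre1996Motifs, Thm. 0.3 (ii) and §2.1 p. 15] -/
theorem pullback_mem_motivatedClasses (hpull : W.motivatedClasses_map_pullback_le)
    (hL : W.HasHardLefschetz) (hP : W.HasProdHyperplaneClasses) {m : ℕ} {Y : SchemeOver k}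
    (hX : IsSmoothProjective n X) (hY : IsSmoothProjective m Y) (f : X ⟶ Y) {p : ℕ}
    {y : W.obj Y (2 * p)} (hy : y ∈ W.motivatedClasses m Y p) :
    W.pullback f (2 * p) y ∈ W.motivatedClasses n X p :=
  hpull hL hP hX hY f p (Submodule.mem_map_of_mem hy)

/-- Under hard Lefschetz and `W.HasProdHyperplaneClasses`, the product polarisation
`pr₁* η_X + pr₂* η_Y` of hyperplane classes has the hard Lefschetz property on `X × Y`
(of dimension `n + m`; André 1996 §1.3, first paragraph: the Künneth isomorphism is an
isomorphism of `𝔰𝔩₂`-modules for the product polarisation). The smooth-projectivity witness of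
`X × Y` is an argument (it is the discharged named fact `IsSmoothProjective.tensor`); the class
`pr₁* η_X + pr₂* η_Y` is `PreWeilCohomology.prodPolarisation` of
`Motives/MotivatedCyclesProduct.lean` (by `rfl`). [cite: Andre1996Motifs, §1.3] -/
theorem bijective_lefschetzPow_prodPolarisation (hP : W.HasProdHyperplaneClasses)
    (hL : W.HasHardLefschetz) {m : ℕ} {Y : SchemeOver k} (hX : IsSmoothProjective n X)
    (hY : IsSmoothProjective m Y) (hXY : IsSmoothProjective (n + m) (X ⊗ Y)) {ηX : W.obj X 2}
    {ηY : W.obj Y 2} (hηX : W.IsHyperplaneClass X ηX) (hηY : W.IsHyperplaneClass Y ηY)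
    {i r j : ℕ} (hr : i + r = n + m) (h : i + 2 * r = j) :
    Function.Bijective
      (W.lefschetzPow (X ⊗ Y) (W.pullback (fst X Y) 2 ηX + W.pullback (snd X Y) 2 ηY) r i j h) :=
  hL hXY _ (hP hX hY hηX hηY) i r j hr h

end WeilCohomology

/-! ## Iterated cup products and Weil-class glue -/

namespace PreWeilCohomology

variable {k : Type u} [Field k] {K : Type v} [Field K] (W : PreWeilCohomology k K)
variable (X : SchemeOver k)

/-- The iterated cup product `H¹(X)^g → Hᵍ(X)`, `(v₀, …, v_{g-1}) ↦ ((1 ∪ v₀) ∪ v₁) ∪ ⋯ ∪ v_{g-1}`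
(empty product `= 1 ∈ H⁰(X)`; note `cupIter 1 v = 1 ∪ v 0`, which equals `v 0` by
`WeilCohomology.one_cup` for `X` smooth projective, not definitionally). Used to map `⋀ᵍ H¹(A) → Hᵍ(A)` for an abelian variety `A`
(Kleiman 1968 §1.2; Moonen–Zarhin 1999 §2 for Weil classes). [cite: Kleiman1968, §1.2] -/
def cupIter : (g : ℕ) → (Fin g → W.obj X 1) → W.obj X g
  | 0, _ => W.one X
  | g + 1, v => W.cup rfl (cupIter g (v ∘ Fin.castSucc)) (v (Fin.last g))

/-- `cupIter 0 v = 1`. [folklore] -/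
@[simp]
lemma cupIter_zero (v : Fin 0 → W.obj X 1) : W.cupIter X 0 v = W.one X := rfl

/-- `cupIter (g+1) v = cupIter g (v ∘ castSucc) ∪ v (last g)`. [folklore] -/
lemma cupIter_succ (g : ℕ) (v : Fin (g + 1) → W.obj X 1) :
    W.cupIter X (g + 1) v = W.cup rfl (W.cupIter X g (v ∘ Fin.castSucc)) (v (Fin.last g)) := rfl

/-- An alternating `g`-linear map `φ : H¹(X)^g → Hᵍ(X)` *is the cup product*: `φ v = cupIter v`
for all `v`. (For a Weil cohomology theory such a `φ` exists, `exists_isCupAlternating`; it is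
introduced relationally because multilinearity and alternation are consequences of the axioms,
not of the bare data.) [folklore] -/
def IsCupAlternating (g : ℕ) (φ : (W.obj X 1) [⋀^Fin g]→ₗ[K] W.obj X g) : Prop :=
  ∀ v : Fin g → W.obj X 1, φ v = W.cupIter X g v

/-- `IsCupAlternating` determines `φ` uniquely. [folklore] -/
lemma IsCupAlternating.unique {g : ℕ} {φ ψ : (W.obj X 1) [⋀^Fin g]→ₗ[K] W.obj X g}
    (hφ : W.IsCupAlternating X g φ) (hψ : W.IsCupAlternating X g ψ) : φ = ψ :=
  AlternatingMap.ext fun v ↦ (hφ v).trans (hψ v).symm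

variable {X} in
/-- The linear map `⋀ᵍ_K H¹(X) →ₗ Hᵍ(X)` induced by an alternating map `φ : H¹(X)^g → Hᵍ(X)`
(the universal property of the exterior power, Mathlib's `exteriorPower.alternatingMapLinearEquiv`);
for `φ` the cup product (`IsCupAlternating`) this is `v₁ ∧ ⋯ ∧ v_g ↦ v₁ ∪ ⋯ ∪ v_g`
(Moonen–Zarhin 1999 §2, Weil classes `⋀^{2p}_E H¹ → H^{2p}`). [cite: MoonenZarhin1999, §2  Weil classes  ⋀^{2p}_E H¹ → H^{2p}] -/
def wedgeToCohomology {g : ℕ} (φ : (W.obj X 1) [⋀^Fin g]→ₗ[K] W.obj X g) :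
    ⋀[K]^g (W.obj X 1) →ₗ[K] W.obj X g :=
  exteriorPower.alternatingMapLinearEquiv φ

/-- `wedgeToCohomology φ (v₁ ∧ ⋯ ∧ v_g) = φ v`. [folklore] -/
@[simp]
lemma wedgeToCohomology_apply_ιMulti {g : ℕ} (φ : (W.obj X 1) [⋀^Fin g]→ₗ[K] W.obj X g)
    (v : Fin g → W.obj X 1) :
    W.wedgeToCohomology φ (exteriorPower.ιMulti K g v) = φ v :=
  exteriorPower.alternatingMapLinearEquiv_apply_ιMulti φ v

/-! ### Cup closure -/

/-- A family of subspaces `F i ⊆ Hⁱ(X)` *is cup-closed*: it contains `1 ∈ H⁰(X)` and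
`x ∈ F i`, `y ∈ F j` imply `x ∪ y ∈ F (i + j)` (i.e. `⨁ F i` is a unital subalgebra of `H•(X)`). [folklore] -/
def IsCupClosed (F : ∀ i, Submodule K (W.obj X i)) : Prop :=
  W.one X ∈ F 0 ∧
    ∀ (i j l : ℕ) (h : i + j = l), ∀ x ∈ F i, ∀ y ∈ F j, W.cup h x y ∈ F l

/-- The whole cohomology `fun i ↦ ⊤` is cup-closed. [folklore] -/
lemma isCupClosed_top : W.IsCupClosed X (fun _ ↦ ⊤) :=
  ⟨trivial, fun _ _ _ _ _ _ _ _ ↦ trivial⟩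

/-- The **cup closure** of a family of subsets `S i ⊆ Hⁱ(X)`: the smallest cup-closed family of
`K`-subspaces of `H•(X)` containing `S` and `1`, i.e. the (graded pieces of the) unital
`K`-subalgebra of `H•(X)` generated by `S` (used for "classes generated by divisor classes and
Weil classes", Moonen–Zarhin 1999 Thm 0.1). Defined as an infimum in the complete lattice of
families of submodules. [cite: MoonenZarhin1999, Thm 0.1] -/
def cupClosure (S : ∀ i, Set (W.obj X i)) : ∀ i, Submodule K (W.obj X i) :=
  sInf {F | (∀ i, S i ⊆ F i) ∧ W.IsCupClosed X F}

variable {X}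

/-- Membership in the cup closure: `x` lies in every cup-closed family containing `S`. [folklore] -/
lemma mem_cupClosure_iff {S : ∀ i, Set (W.obj X i)} {i : ℕ} {x : W.obj X i} :
    x ∈ W.cupClosure X S i ↔
      ∀ F : ∀ i, Submodule K (W.obj X i), (∀ i, S i ⊆ F i) → W.IsCupClosed X F → x ∈ F i := by
  rw [cupClosure, sInf_apply, Submodule.mem_iInf]
  exact ⟨fun h F hS hF ↦ h ⟨F, hS, hF⟩, fun h F ↦ h F F.2.1 F.2.2⟩

/-- `S i ⊆ cupClosure S i`. [folklore] -/
lemma subset_cupClosure (S : ∀ i, Set (W.obj X i)) (i : ℕ) :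
    S i ⊆ W.cupClosure X S i :=
  fun _ hx ↦ W.mem_cupClosure_iff.mpr fun _ hS _ ↦ hS i hx

/-- `1 ∈ cupClosure S 0`. [folklore] -/
lemma one_mem_cupClosure (S : ∀ i, Set (W.obj X i)) : W.one X ∈ W.cupClosure X S 0 :=
  W.mem_cupClosure_iff.mpr fun _ _ hF ↦ hF.1

/-- The cup closure is closed under cup products. [folklore] -/
lemma cup_mem_cupClosure (S : ∀ i, Set (W.obj X i)) {i j l : ℕ} (h : i + j = l)
    {x : W.obj X i} {y : W.obj X j} (hx : x ∈ W.cupClosure X S i)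
    (hy : y ∈ W.cupClosure X S j) : W.cup h x y ∈ W.cupClosure X S l :=
  W.mem_cupClosure_iff.mpr fun F hS hF ↦
    hF.2 i j l h x (W.mem_cupClosure_iff.mp hx F hS hF) y (W.mem_cupClosure_iff.mp hy F hS hF)

/-- The cup closure is cup-closed. [folklore] -/
lemma isCupClosed_cupClosure (S : ∀ i, Set (W.obj X i)) :
    W.IsCupClosed X (W.cupClosure X S) :=
  ⟨W.one_mem_cupClosure S, fun _ _ _ h _ hx _ hy ↦ W.cup_mem_cupClosure S h hx hy⟩

/-- The cup closure is the smallest cup-closed family containing `S`. [folklore] -/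
lemma cupClosure_le {S : ∀ i, Set (W.obj X i)} {F : ∀ i, Submodule K (W.obj X i)}
    (hS : ∀ i, S i ⊆ F i) (hF : W.IsCupClosed X F) : W.cupClosure X S ≤ F :=
  sInf_le ⟨hS, hF⟩

end PreWeilCohomology

namespace WeilCohomology

variable {k : Type u} [Field k] {K : Type v} [Field K] [CharZero K] (W : WeilCohomology k K)
variable {n : ℕ} {X : SchemeOver k}

/-- **The cup product on `H¹` is alternating** (Kleiman 1968 §1.2: `H•(X)` is a
graded-commutative `K`-algebra): for `X` smooth projective there is a (unique,
`IsCupAlternating.unique`) alternating `g`-linear map `H¹(X)^g → Hᵍ(X)` computing the iterated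
cup product. Multilinearity comes from bilinearity of `cup`; alternation from `cup_assoc`,
`cup_comm` in odd degree (`v ∪ v = - v ∪ v`) and `CharZero K`. [cite: Kleiman1968, §1.2:  H•(X] -/
def exists_isCupAlternating : Prop :=
  ∀ {n : ℕ} {X : SchemeOver k}, IsSmoothProjective n X → ∀ g : ℕ,
    ∃ φ : (W.obj X 1) [⋀^Fin g]→ₗ[K] W.obj X g, W.IsCupAlternating X g φ

end WeilCohomology

end Literature.AlgebraicGeometry.Motives

end
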